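import Literature.NumberTheory.LFunctions.HalfIsolatedZeroMellin
import Literature.NumberTheory.LFunctions.HalfIsolatedZeroZeroSums
import Literature.Analysis.Complex.MaynardPrattPowerSum
import Mathlib.Analysis.SpecialFunctions.Trigonometric.Bounds
import HarnessLib

/-!
# Half-isolated zeros (Maynard–Pratt 2024), VI: Lemma 15 from Lemma 11

Topic `Literature/NumberTheory/LFunctions`. Everything in this file is PROVED (no definition, no
named fact). Part of the in-tree proof of Proposition 16 of

* J. Maynard, K. Pratt, *Half-isolated zeros and zero-density estimates*, IMRN 2024 =
  arXiv:2206.11729,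

as a consequence of the named fact `Literature.Analysis.Complex.MaynardPratt2024_lemma11` (Lemma 11,
the refined power-sum estimate, `Literature/Analysis/Complex/MaynardPrattPowerSum.lean`; discharged
in the tree, `MaynardPrattPowerSumProofs.lean`), taken here as a hypothesis `h11`:

* `MaynardPratt.lemma15` — **Lemma 15** (large values of the zero sum, p. 9) in the concrete form
  consumed by Proposition 16 (`HalfIsolatedZeroProofs.lean`): Lemma 11 with `z_ρ = ρ − ρ₀`,
  `c_ρ = m(ρ)W₀(ρ−ρ₀)/(m(ρ₀) log 2)` (zeros weighted by multiplicity; `W₀(0) = log 2` makes the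
  distinguished coefficient `1`), `A = log Y`, `B = K₁ log T` (from `Σ_ρ m(ρ)/(1+(γ−γ₀)²) ≪ log T`,
  `HalfIsolatedZeroZeroSums.lean`, and `|W₀(σ+it)| ≪ 1/(1+t²)`, `HalfIsolatedZeroMellin.lean`),
  near-positivity of the `c_ρ` with `|Im z_ρ| ≤ (log B)²/A` from `|W₀(s) − log 2| ≤ 5|s|`
  (`abs_arg_log_two_add_le`), then the mean value theorem for `f(t) = Σ c_ρ e^{t z_ρ}`
  (`norm_powerSum_sub_le`, `|f'| ≤ 2D` on `[0, 3A]`) and the grid `ℓℕ`, `ℓ = log(1 + (log T)^{−150})`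
  (`exists_nat_mul_mem_Icc`). Output: some `U = e^{jℓ}` with `log U ∈ [log Y, 2 log Y]` and
  `|Σ_{ρ∈𝒮} m(ρ)U^{ρ−ρ₀}W₀(ρ−ρ₀)| ≥ 2(log T)^{−100}`.
* Tools: `abs_arg_le_of_abs_im_le`, `sum_order_norm_W0_le`, `mul_sum_coeff_eq`, and the threshold
  arithmetic `grid_step_le`, `final_step_le`, `window_le`.

## References

* J. Maynard, K. Pratt, IMRN 2024:19, 12978–13014 = arXiv:2206.11729, Lemmas 11 and 15 and the
  proof of Lemma 15 (p. 8–10). (`MaynardPratt2024`)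
-/

noncomputable section

open Complex Real Set Filter Metric MeasureTheory
open scoped Topology Nat

namespace Literature.NumberTheory.LFunctions


namespace MaynardPratt

/-! ## Helpers -/

/-- If `Re u > 0` and `|Im u| ≤ Re u / 10` then `|arg u| ≤ 1/10`. [folklore] -/
theorem abs_arg_le_of_abs_im_le {u : ℂ} (hre : 0 < u.re) (him : |u.im| ≤ u.re / 10) :
    |u.arg| ≤ 1 / 10 := by
  have hlt : |u.arg| < π / 2 := Complex.abs_arg_lt_pi_div_two_iff.2 (Or.inl hre)
  by_contra h
  push Not at h
  have htan : Real.tan u.arg = u.im / u.re := Complex.tan_arg u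
  have h1 : |Real.tan u.arg| ≤ 1 / 10 := by
    rw [htan, abs_div, abs_of_pos hre, div_le_iff₀ hre]
    linarith
  have h2 : |u.arg| ≤ Real.tan |u.arg| := Real.le_tan (abs_nonneg _) hlt
  have h3 : Real.tan |u.arg| = |Real.tan u.arg| := by
    rcases le_or_gt 0 u.arg with h0 | h0
    · rw [abs_of_nonneg h0, abs_of_nonneg (Real.tan_nonneg_of_nonneg_of_le_pi_div_two h0 ?_)]
      rw [abs_of_nonneg h0] at hlt; exact hlt.le
    · rw [abs_of_neg h0, Real.tan_neg, abs_of_neg]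
      apply Real.tan_neg_of_neg_of_pi_div_two_lt h0
      rw [abs_of_neg h0] at hlt; linarith
  linarith

/-- `|arg(log 2 + w)| ≤ 1/10` for `|w| ≤ 1/20`. [folklore] -/
theorem abs_arg_log_two_add_le {w : ℂ} (hw : ‖w‖ ≤ 1 / 20) :
    |((Real.log 2 : ℂ) + w).arg| ≤ 1 / 10 := by
  have hlog2 : (0.6931471803 : ℝ) < Real.log 2 := Real.log_two_gt_d9
  have hwre : |w.re| ≤ 1 / 20 := (Complex.abs_re_le_norm w).trans hw
  have hwim : |w.im| ≤ 1 / 20 := (Complex.abs_im_le_norm w).trans hw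
  rw [abs_le] at hwre
  refine abs_arg_le_of_abs_im_le ?_ ?_
  · simp only [add_re, ofReal_re]; linarith [hwre.1]
  · simp only [add_re, ofReal_re, add_im, ofReal_im, zero_add]
    linarith [hwre.1]

/-- Grid lemma: for `0 < ℓ ≤ A` and `A ≤ t₀ ≤ 2A`, some integer multiple `jℓ` lies in `[A, 2A]`
within `ℓ` of `t₀`. [folklore] -/
theorem exists_nat_mul_mem_Icc {ℓ A t₀ : ℝ} (hℓ : 0 < ℓ) (hℓA : ℓ ≤ A) (h1 : A ≤ t₀)
    (h2 : t₀ ≤ 2 * A) :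
    ∃ j : ℕ, A ≤ j * ℓ ∧ j * ℓ ≤ 2 * A ∧ |j * ℓ - t₀| ≤ ℓ := by
  have ht₀ : 0 ≤ t₀ := by linarith
  set j := ⌊t₀ / ℓ⌋₊ with hj
  have hjle : (j : ℝ) * ℓ ≤ t₀ := by
    have := Nat.floor_le (div_nonneg ht₀ hℓ.le)
    rw [← hj] at this
    calc (j : ℝ) * ℓ ≤ t₀ / ℓ * ℓ := by gcongr
      _ = t₀ := div_mul_cancel₀ _ hℓ.ne'
  have hjlt : t₀ < ((j : ℝ) + 1) * ℓ := by
    have := Nat.lt_floor_add_one (t₀ / ℓ)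
    rw [← hj] at this
    calc t₀ = t₀ / ℓ * ℓ := (div_mul_cancel₀ _ hℓ.ne').symm
      _ < ((j : ℝ) + 1) * ℓ := by gcongr
  by_cases hcase : A ≤ (j : ℝ) * ℓ
  · refine ⟨j, hcase, by linarith, ?_⟩
    rw [abs_le]; constructor <;> linarith
  · push Not at hcase
    refine ⟨j + 1, ?_, ?_, ?_⟩
    · push_cast; linarith
    · push_cast; linarith
    · push_cast; rw [abs_le]; constructor <;> linarith

/-- `log(2T + 2) ≤ 2 log T` for `T ≥ 4`. [folklore] -/
theorem log_two_mul_add_two_le {T : ℝ} (hT : 4 ≤ T) : Real.log (2 * T + 2) ≤ 2 * Real.log T := by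
  rw [show 2 * Real.log T = Real.log (T ^ 2) by rw [Real.log_pow]; norm_num]
  exact Real.log_le_log (by linarith) (by nlinarith)

/-- For a non-trivial zero at height `γ₀ ∈ [T, 2T]`, `T ≥ 4`: `log(|γ₀| + 2) ≤ 2 log T`. [folklore] -/
theorem log_abs_im_add_two_le {T γ : ℝ} (hT : 4 ≤ T) (h1 : T ≤ γ) (h2 : γ ≤ 2 * T) :
    Real.log (|γ| + 2) ≤ 2 * Real.log T := by
  have hγ : 0 ≤ γ := by linarith
  rw [abs_of_nonneg hγ]
  exact (Real.log_le_log (by linarith) (by linarith)).trans (log_two_mul_add_two_le hT)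

open ZetaZeros.riemannZetaNontrivialZeros in
/-- The bound `|W₀(ρ − ρ₀)| ≤ 2C_b/(1 + (γ − γ₀)²)` for zeros with `|β − β₀| ≤ 1`. [folklore] -/
theorem norm_W0_sub_le_of_re {Cb : ℝ}
    (hCb : ∀ s : ℂ, ‖mellin (fun x : ℝ ↦ ((w0 x : ℝ) : ℂ)) s‖ ≤ Cb * (2 : ℝ) ^ |s.re| / (1 + s.im ^ 2))
    {ρ ρ₀ : ℂ} (hre : |ρ.re - ρ₀.re| ≤ 1) :
    ‖mellin (fun x : ℝ ↦ ((w0 x : ℝ) : ℂ)) (ρ - ρ₀)‖ ≤ 2 * Cb / (1 + (ρ.im - ρ₀.im) ^ 2) := by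
  have h := hCb (ρ - ρ₀)
  have hCb0 : 0 ≤ Cb := by
    have h0 := hCb 0
    simp only [zero_re, abs_zero, Real.rpow_zero, mul_one, zero_im] at h0
    norm_num at h0
    exact (norm_nonneg _).trans h0
  have h2 : (2 : ℝ) ^ |(ρ - ρ₀).re| ≤ 2 := by
    rw [sub_re]
    calc (2 : ℝ) ^ |ρ.re - ρ₀.re| ≤ 2 ^ (1 : ℝ) := Real.rpow_le_rpow_of_exponent_le one_le_two hre
      _ = 2 := Real.rpow_one 2
  calc ‖mellin (fun x : ℝ ↦ ((w0 x : ℝ) : ℂ)) (ρ - ρ₀)‖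
      ≤ Cb * 2 ^ |(ρ - ρ₀).re| / (1 + (ρ - ρ₀).im ^ 2) := h
    _ ≤ Cb * 2 / (1 + (ρ - ρ₀).im ^ 2) := by gcongr
    _ = 2 * Cb / (1 + (ρ.im - ρ₀.im) ^ 2) := by rw [sub_im]; ring

open ZetaZeros.riemannZetaNontrivialZeros in
/-- **`Σ_{ρ∈𝒮} m(ρ)|W₀(ρ−ρ₀)| ≪ log T`** and **`Σ_{ρ∈𝒮} m(ρ)|W₀(ρ−ρ₀)||ρ−ρ₀| ≪ (log T)³`** for a
finite set `𝒮` of non-trivial zeros with `|β − β₀| ≤ 1`, `|ρ − ρ₀| ≤ (log T)²`, `γ₀ ∈ [T, 2T]`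
(the estimates "`Σ|W(ρ−ρ₀)| ≪ log T`" and "`|f'(t)| ≪ (log T)³`" of the proof of Lemma 15).
[cite: MaynardPratt2024, Lemma 15 (proof)] -/
theorem sum_order_norm_W0_le {Cb C₁ : ℝ}
    (hCb : ∀ s : ℂ, ‖mellin (fun x : ℝ ↦ ((w0 x : ℝ) : ℂ)) s‖ ≤ Cb * (2 : ℝ) ^ |s.re| / (1 + s.im ^ 2))
    (hC₁ : ∀ (t : ℝ) (F : Finset ℂ), (∀ ρ ∈ F, ρ ∈ RHWave0.riemannZetaNontrivialZeros) →
      ∑ ρ ∈ F, (riemannZetaZeroOrder ρ : ℝ) / (1 + (ρ.im - t) ^ 2) ≤ C₁ * Real.log (|t| + 2))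
    {T : ℝ} {ρ₀ : ℂ} {S : Finset ℂ} (hT : 4 ≤ T) (hγ1 : T ≤ ρ₀.im) (hγ2 : ρ₀.im ≤ 2 * T)
    (hS : ∀ ρ ∈ S, ρ ∈ RHWave0.riemannZetaNontrivialZeros ∧ |ρ.re - ρ₀.re| ≤ 1 ∧
      ‖ρ - ρ₀‖ ≤ Real.log T ^ 2) :
    ∑ ρ ∈ S, (riemannZetaZeroOrder ρ : ℝ) * ‖mellin (fun x : ℝ ↦ ((w0 x : ℝ) : ℂ)) (ρ - ρ₀)‖ ≤
      4 * Cb * C₁ * Real.log T ∧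
    ∑ ρ ∈ S, (riemannZetaZeroOrder ρ : ℝ) * ‖mellin (fun x : ℝ ↦ ((w0 x : ℝ) : ℂ)) (ρ - ρ₀)‖ *
        ‖ρ - ρ₀‖ ≤ 4 * Cb * C₁ * Real.log T ^ 3 := by
  have hm : ∀ ρ ∈ S, (0 : ℝ) ≤ riemannZetaZeroOrder ρ := fun ρ hρ ↦
    riemannZetaZeroOrder_nonneg_of_zero (zeta_eq_zero (hS ρ hρ).1)
  have hCb0 : 0 ≤ Cb := by
    have h0 := hCb 0
    simp only [zero_re, abs_zero, Real.rpow_zero, mul_one, zero_im] at h0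
    norm_num at h0
    exact (norm_nonneg _).trans h0
  have hsum : ∑ ρ ∈ S, (riemannZetaZeroOrder ρ : ℝ) / (1 + (ρ.im - ρ₀.im) ^ 2) ≤
      2 * C₁ * Real.log T := by
    refine (hC₁ ρ₀.im S fun ρ hρ ↦ (hS ρ hρ).1).trans ?_
    have h1 := log_abs_im_add_two_le hT hγ1 hγ2
    have hC₁0 : 0 ≤ C₁ := by
      have := hC₁ 0 ∅ (by simp)
      simp at this
      nlinarith [Real.log_pos (by norm_num : (1 : ℝ) < 2)]
    nlinarith
  have key : ∑ ρ ∈ S, (riemannZetaZeroOrder ρ : ℝ) * ‖mellin (fun x : ℝ ↦ ((w0 x : ℝ) : ℂ)) (ρ - ρ₀)‖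
      ≤ 4 * Cb * C₁ * Real.log T := by
    calc ∑ ρ ∈ S, (riemannZetaZeroOrder ρ : ℝ) * ‖mellin (fun x : ℝ ↦ ((w0 x : ℝ) : ℂ)) (ρ - ρ₀)‖
        ≤ ∑ ρ ∈ S, (riemannZetaZeroOrder ρ : ℝ) * (2 * Cb / (1 + (ρ.im - ρ₀.im) ^ 2)) :=
          Finset.sum_le_sum fun ρ hρ ↦ mul_le_mul_of_nonneg_left
            (norm_W0_sub_le_of_re hCb (hS ρ hρ).2.1) (hm ρ hρ)
      _ = 2 * Cb * ∑ ρ ∈ S, (riemannZetaZeroOrder ρ : ℝ) / (1 + (ρ.im - ρ₀.im) ^ 2) := by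
          rw [Finset.mul_sum]; refine Finset.sum_congr rfl fun ρ _ ↦ by ring
      _ ≤ 2 * Cb * (2 * C₁ * Real.log T) := by gcongr
      _ = _ := by ring
  refine ⟨key, ?_⟩
  have hL0 : 0 ≤ Real.log T := Real.log_nonneg (by linarith)
  calc ∑ ρ ∈ S, (riemannZetaZeroOrder ρ : ℝ) * ‖mellin (fun x : ℝ ↦ ((w0 x : ℝ) : ℂ)) (ρ - ρ₀)‖ *
        ‖ρ - ρ₀‖
      ≤ ∑ ρ ∈ S, (riemannZetaZeroOrder ρ : ℝ) * ‖mellin (fun x : ℝ ↦ ((w0 x : ℝ) : ℂ)) (ρ - ρ₀)‖ *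
        Real.log T ^ 2 := Finset.sum_le_sum fun ρ hρ ↦ mul_le_mul_of_nonneg_left (hS ρ hρ).2.2
          (mul_nonneg (hm ρ hρ) (norm_nonneg _))
    _ = (∑ ρ ∈ S, (riemannZetaZeroOrder ρ : ℝ) * ‖mellin (fun x : ℝ ↦ ((w0 x : ℝ) : ℂ)) (ρ - ρ₀)‖) *
        Real.log T ^ 2 := (Finset.sum_mul _ _ _).symm
    _ ≤ (4 * Cb * C₁ * Real.log T) * Real.log T ^ 2 := by gcongr
    _ = _ := by ring

/-- **Mean-value step for the power sum** `g(t) = Σ_ρ c_ρ e^{t z_ρ}`: if `Re z_ρ ≤ 1/(10A)` and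
`Σ |c_ρ||z_ρ| ≤ D`, then `|g(t) − g(t')| ≤ 2D|t − t'|` for `t, t' ∈ [0, 3A]` (`|e^{t z}| ≤ e^{3/10} ≤ 2`
there). [cite: MaynardPratt2024, Lemma 15 (proof)] -/
theorem norm_powerSum_sub_le {S : Finset ℂ} {c z : ℂ → ℂ} {A D : ℝ} (hA : 0 < A)
    (hz : ∀ ρ ∈ S, (z ρ).re ≤ 1 / (10 * A)) (hD : ∑ ρ ∈ S, ‖c ρ‖ * ‖z ρ‖ ≤ D)
    {t t' : ℝ} (ht : t ∈ Icc (0 : ℝ) (3 * A)) (ht' : t' ∈ Icc (0 : ℝ) (3 * A)) :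
    ‖∑ ρ ∈ S, c ρ * cexp ((t : ℂ) * z ρ) - ∑ ρ ∈ S, c ρ * cexp ((t' : ℂ) * z ρ)‖ ≤
      2 * D * |t - t'| := by
  set g : ℝ → ℂ := fun t ↦ ∑ ρ ∈ S, c ρ * cexp ((t : ℂ) * z ρ) with hg
  have hgd : ∀ t : ℝ, HasDerivAt g (∑ ρ ∈ S, c ρ * (cexp ((t : ℂ) * z ρ) * z ρ)) t := by
    intro t
    rw [hg]
    refine HasDerivAt.fun_sum fun ρ _ ↦ ?_
    have h1 : HasDerivAt (fun y : ℝ ↦ (y : ℂ) * z ρ) (z ρ) t := by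
      simpa using (Complex.ofRealCLM.hasDerivAt (x := t)).mul_const (z ρ)
    exact h1.cexp.const_mul (c ρ)
  have hexp : ∀ s ∈ Icc (0 : ℝ) (3 * A), ∀ ρ ∈ S, ‖cexp ((s : ℂ) * z ρ)‖ ≤ 2 := by
    intro s hs ρ hρ
    rw [Complex.norm_exp, Complex.re_ofReal_mul]
    have h1 : s * (z ρ).re ≤ 3 / 10 := by
      calc s * (z ρ).re ≤ (3 * A) * (1 / (10 * A)) := by
            rcases le_or_gt 0 (z ρ).re with h0 | h0
            · exact mul_le_mul hs.2 (hz ρ hρ) h0 (by positivity)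
            · exact (mul_nonpos_of_nonneg_of_nonpos hs.1 h0.le).trans (by positivity)
        _ = 3 / 10 := by field_simp
    calc Real.exp (s * (z ρ).re) ≤ Real.exp (3 / 10) := Real.exp_le_exp.2 h1
      _ ≤ 2 := by
          have h3 : Real.exp (3 / 10) * Real.exp (-(3 / 10)) = 1 := by
            rw [← Real.exp_add]; norm_num
          have h4 : 1 - 3 / 10 ≤ Real.exp (-(3 / 10) : ℝ) := by
            linarith [Real.add_one_le_exp (-(3 / 10) : ℝ)]
          nlinarith [Real.exp_pos (3 / 10 : ℝ), Real.exp_pos (-(3 / 10) : ℝ)]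
  have hg'b : ∀ s ∈ Icc (0 : ℝ) (3 * A), ‖∑ ρ ∈ S, c ρ * (cexp ((s : ℂ) * z ρ) * z ρ)‖ ≤ 2 * D := by
    intro s hs
    calc ‖∑ ρ ∈ S, c ρ * (cexp ((s : ℂ) * z ρ) * z ρ)‖
        ≤ ∑ ρ ∈ S, ‖c ρ * (cexp ((s : ℂ) * z ρ) * z ρ)‖ := norm_sum_le _ _
      _ ≤ ∑ ρ ∈ S, ‖c ρ‖ * ‖z ρ‖ * 2 := by
          refine Finset.sum_le_sum fun ρ hρ ↦ ?_
          rw [norm_mul, norm_mul]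
          calc ‖c ρ‖ * (‖cexp ((s : ℂ) * z ρ)‖ * ‖z ρ‖) ≤ ‖c ρ‖ * (2 * ‖z ρ‖) := by
                gcongr; exact hexp s hs ρ hρ
            _ = _ := by ring
      _ = (∑ ρ ∈ S, ‖c ρ‖ * ‖z ρ‖) * 2 := (Finset.sum_mul _ _ _).symm
      _ ≤ D * 2 := by gcongr
      _ = 2 * D := mul_comm _ _
  have hmv := (convex_Icc (0 : ℝ) (3 * A)).norm_image_sub_le_of_norm_hasDerivWithin_le
    (fun s _ ↦ (hgd s).hasDerivWithinAt) hg'b ht' ht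
  rw [hg] at hmv
  simpa [Real.norm_eq_abs] using hmv

/-- The coefficient identity and the main-sum identity behind Lemma 15: with
`c_ρ = m(ρ)W₀(ρ−ρ₀)/(m₀ log 2)`, `m₀ log 2 · Σ c_ρ e^{u(ρ−ρ₀)} = Σ m(ρ) e^{u(ρ−ρ₀)} W₀(ρ−ρ₀)`.
[folklore] -/
theorem mul_sum_coeff_eq (S : Finset ℂ) (ρ₀ : ℂ) {m₀ : ℝ} (hm₀ : m₀ ≠ 0) (u : ℝ) :
    ((m₀ : ℂ) * (Real.log 2 : ℂ)) * ∑ ρ ∈ S,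
      (riemannZetaZeroOrder ρ : ℂ) * mellin (fun x : ℝ ↦ ((w0 x : ℝ) : ℂ)) (ρ - ρ₀) /
        ((m₀ : ℂ) * (Real.log 2 : ℂ)) * cexp ((u : ℂ) * (ρ - ρ₀)) =
    ∑ ρ ∈ S, (riemannZetaZeroOrder ρ : ℂ) *
      (cexp ((u : ℂ) * (ρ - ρ₀)) * mellin (fun x : ℝ ↦ ((w0 x : ℝ) : ℂ)) (ρ - ρ₀)) := by
  have h2 : (Real.log 2 : ℂ) ≠ 0 := by
    exact_mod_cast (Real.log_pos (by norm_num : (1 : ℝ) < 2)).ne'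
  have hm : (m₀ : ℂ) ≠ 0 := by exact_mod_cast hm₀
  rw [Finset.mul_sum]
  refine Finset.sum_congr rfl fun ρ _ ↦ ?_
  field_simp

/-- Threshold arithmetic for Lemma 15, grid step: `K₃ L³ · L^{−150} ≤ ((K₁L)^{99})⁻¹/4` once
`L ≥ 4K₃K₁^{99} + 1`, `L ≥ 1`. [folklore] -/
theorem grid_step_le {K₁ K₃ L : ℝ} (hK₁ : 1 ≤ K₁) (hL1 : 1 ≤ L)
    (hL : 4 * K₃ * K₁ ^ 99 + 1 ≤ L) :
    K₃ * L ^ 3 * (L ^ 150)⁻¹ ≤ ((K₁ * L) ^ 99)⁻¹ / 4 := by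
  have hL0 : 0 < L := by linarith
  have key : 4 * K₃ * K₁ ^ 99 * L ^ 102 ≤ L ^ 150 := by
    calc 4 * K₃ * K₁ ^ 99 * L ^ 102 ≤ L * L ^ 102 := by gcongr; linarith
      _ = L ^ 103 := by ring
      _ ≤ L ^ 150 := pow_le_pow_right₀ hL1 (by norm_num)
  have hpos1 : (0 : ℝ) < L ^ 150 := by positivity
  have hpos2 : (0 : ℝ) < (K₁ * L) ^ 99 := by positivity
  calc K₃ * L ^ 3 * (L ^ 150)⁻¹ = (4 * K₃ * K₁ ^ 99 * L ^ 102) / (4 * (K₁ * L) ^ 99 * L ^ 150) := by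
        field_simp
    _ ≤ L ^ 150 / (4 * (K₁ * L) ^ 99 * L ^ 150) := by gcongr
    _ = ((K₁ * L) ^ 99)⁻¹ / 4 := by
        field_simp

/-- Threshold arithmetic for Lemma 15, final step: `2/L^{100} ≤ log 2 · ((K₁L)^{99})⁻¹/2` once
`L ≥ 4K₁^{99}/log 2`. [folklore] -/
theorem final_step_le {K₁ L : ℝ} (hK₁ : 1 ≤ K₁) (hL1 : 1 ≤ L) (hL : 4 * K₁ ^ 99 / Real.log 2 ≤ L) :
    2 / L ^ 100 ≤ Real.log 2 * (((K₁ * L) ^ 99)⁻¹ / 2) := by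
  have hlog2 : 0 < Real.log 2 := Real.log_pos (by norm_num)
  have hL0 : 0 < L := by linarith
  have hL' : 4 * K₁ ^ 99 ≤ Real.log 2 * L := by
    rw [div_le_iff₀ hlog2] at hL; linarith
  rw [mul_pow, show Real.log 2 * ((K₁ ^ 99 * L ^ 99)⁻¹ / 2) = Real.log 2 / (2 * (K₁ ^ 99 * L ^ 99)) by
    ring, div_le_div_iff₀ (by positivity) (by positivity)]
  calc 2 * (2 * (K₁ ^ 99 * L ^ 99)) = (4 * K₁ ^ 99) * L ^ 99 := by ring
    _ ≤ (Real.log 2 * L) * L ^ 99 := by gcongr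
    _ = Real.log 2 * L ^ 100 := by ring

/-- Threshold arithmetic for Lemma 15, positivity window: `(1 + (log B)²)/A ≤ 1/100` when
`log B ≤ 2 log L`, `0 ≤ log B`, `500 ≤ log L` and `(log L)³ ≤ A`. [folklore] -/
theorem window_le {A B L : ℝ} (hA : Real.log L ^ 3 ≤ A) (hlogL : 500 ≤ Real.log L)
    (hlogB : Real.log B ≤ 2 * Real.log L) (hlogB0 : 0 ≤ Real.log B) :
    (1 + Real.log B ^ 2) / A ≤ 1 / 100 := by
  have hA0 : 0 < A := lt_of_lt_of_le (by positivity) hA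
  rw [div_le_div_iff₀ hA0 (by norm_num), one_mul]
  have h1 : Real.log B ^ 2 ≤ 4 * Real.log L ^ 2 := by nlinarith
  nlinarith

set_option maxHeartbeats 1000000 in
open ZetaZeros.riemannZetaNontrivialZeros in
/-- **Maynard–Pratt, Lemma 15** (large values of the zero sum; p. 9), in the concrete form used for
Proposition 16, CONDITIONAL on the named fact `MaynardPratt2024_lemma11` (Lemma 11): there is an
absolute `L₁` such that for `log T ≥ L₁`, `(log log T)³ ≤ log Y ≤ log T`, a non-trivial zero
`ρ₀ = β₀ + iγ₀` with `γ₀ ∈ [T, 2T]`, and any finite set `𝒮 ∋ ρ₀` of non-trivial zeros `ρ = β + iγ`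
with `γ ≥ γ₀`, `|β − β₀| ≤ 1/(10 log Y)`, `|ρ − ρ₀| ≤ (log T)²` (the set `𝒮_≈(ρ₀)`), there is
`U = e^{jℓ}` on the grid `ℓ = log(1 + (log T)^{−150})`, `j ∈ ℕ`, with `log U ∈ [log Y, 2 log Y]`
and `|Σ_{ρ∈𝒮} m(ρ) U^{ρ−ρ₀} W₀(ρ−ρ₀)| ≥ 2 (log T)^{−100}` (zeros weighted by their multiplicity;
`W₀(0) = log 2` makes the distinguished coefficient `1` after dividing by `m(ρ₀) log 2`).
The proof is the printed one: Lemma 11 with `z_ρ = ρ − ρ₀`, `c_ρ = m(ρ)W₀(ρ−ρ₀)/(m(ρ₀) log 2)`,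
`A = log Y`, `B ≍ log T` (from `Σ_ρ m(ρ)/(1+(γ−γ₀)²) ≪ log T` and `|W₀(s)| ≪ 1/(1+t²)`), the
near-positivity from `W₀(s) = log 2 + O(|s|)`, then `|f'| ≪ (log T)³` on `[0, 3 log Y]` and the grid.
[cite: MaynardPratt2024, Lemma 15] -/
theorem lemma15 (h11 : Literature.Analysis.Complex.MaynardPratt2024_lemma11) :
    ∃ L₁ : ℝ, 0 < L₁ ∧ ∀ (T Y : ℝ) (ρ₀ : ℂ) (S : Finset ℂ),
      L₁ ≤ Real.log T → Real.log (Real.log T) ^ 3 ≤ Real.log Y → Real.log Y ≤ Real.log T →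
      ρ₀ ∈ RHWave0.riemannZetaNontrivialZeros → T ≤ ρ₀.im → ρ₀.im ≤ 2 * T → ρ₀ ∈ S →
      (∀ ρ ∈ S, ρ ∈ RHWave0.riemannZetaNontrivialZeros ∧ ρ₀.im ≤ ρ.im ∧
        |ρ.re - ρ₀.re| ≤ 1 / (10 * Real.log Y) ∧ ‖ρ - ρ₀‖ ≤ Real.log T ^ 2) →
      ∃ j : ℕ, Real.log Y ≤ j * Real.log (1 + (Real.log T ^ 150)⁻¹) ∧
        j * Real.log (1 + (Real.log T ^ 150)⁻¹) ≤ 2 * Real.log Y ∧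
        2 / Real.log T ^ 100 ≤ ‖∑ ρ ∈ S, (riemannZetaZeroOrder ρ : ℂ) *
          (cexp (((j * Real.log (1 + (Real.log T ^ 150)⁻¹) : ℝ) : ℂ) * (ρ - ρ₀)) *
            mellin (fun x : ℝ ↦ ((w0 x : ℝ) : ℂ)) (ρ - ρ₀))‖ := by
  obtain ⟨B₀, h11⟩ := h11
  obtain ⟨Cb, hCb0, hCb⟩ := exists_norm_W0_le_div_one_add_sq
  obtain ⟨C₁, hC₁0, hC₁⟩ := exists_sum_order_div_one_add_sq_le
  have hlog2 : (0.6931471803 : ℝ) < Real.log 2 := Real.log_two_gt_d9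
  have hlog2' : Real.log 2 < 0.6931471808 := Real.log_two_lt_d9
  -- constants
  set K₁ : ℝ := 4 * Cb * C₁ / Real.log 2 + 1 with hK₁
  have hK₁1 : 1 ≤ K₁ := by
    have : 0 ≤ 4 * Cb * C₁ / Real.log 2 := by positivity
    linarith
  set K₃ : ℝ := 4 * Cb * C₁ / Real.log 2 with hK₃
  have hK₃0 : 0 ≤ K₃ := by rw [hK₃]; positivity
  set L₁ : ℝ := max (max (max B₀ (Real.exp 500)) (max K₁ (4 * K₃ * K₁ ^ 99 + 1)))
    (4 * K₁ ^ 99 / Real.log 2) with hL₁_def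
  have hL₁e : Real.exp 500 ≤ L₁ :=
    le_trans (le_max_right _ _) (le_trans (le_max_left _ _) (le_max_left _ _))
  have hL₁B : B₀ ≤ L₁ := le_trans (le_max_left _ _) (le_trans (le_max_left _ _) (le_max_left _ _))
  have hL₁K : K₁ ≤ L₁ := le_trans (le_max_left _ _) (le_trans (le_max_right _ _) (le_max_left _ _))
  have hL₁g : 4 * K₃ * K₁ ^ 99 + 1 ≤ L₁ :=
    le_trans (le_max_right _ _) (le_trans (le_max_right _ _) (le_max_left _ _))
  have hL₁f : 4 * K₁ ^ 99 / Real.log 2 ≤ L₁ := le_max_right _ _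
  refine ⟨L₁, lt_of_lt_of_le (Real.exp_pos 500) hL₁e, ?_⟩
  intro T Y ρ₀ S hL hA1 hA2 hρ₀ hγ1 hγ2 hρ₀S hS
  -- basic quantities
  set L := Real.log T with hL_def
  set A := Real.log Y with hA_def
  have h500 : (500 : ℝ) + 1 ≤ Real.exp 500 := Real.add_one_le_exp 500
  have hL500 : 501 ≤ L := by linarith
  have hL1 : 1 ≤ L := by linarith
  have hL0 : 0 < L := by linarith
  have hT0 : 0 < T := by
    have h1 : 0 ≤ T := by linarith
    rcases h1.lt_or_eq with h | h
    · exact h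
    · exfalso; rw [← h, Real.log_zero] at hL_def; linarith
  have hT4 : 4 ≤ T := by
    by_contra h
    push Not at h
    have h3 : L < Real.log 4 := Real.log_lt_log hT0 h
    have h4 : Real.log 4 ≤ 4 := by
      rw [Real.log_le_iff_le_exp (by norm_num)]; linarith [Real.add_one_le_exp (4 : ℝ)]
    linarith
  have hlogL : 500 ≤ Real.log L := by
    rw [Real.le_log_iff_exp_le hL0]; linarith
  have hlogL0 : 0 < Real.log L := by linarith
  have hA0 : 0 < A := lt_of_lt_of_le (by positivity) hA1
  -- multiplicities
  have hmS : ∀ ρ ∈ S, (1 : ℝ) ≤ riemannZetaZeroOrder ρ := fun ρ hρ ↦ by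
    exact_mod_cast one_le_order (hS ρ hρ).1
  set m₀ : ℝ := (riemannZetaZeroOrder ρ₀ : ℝ) with hm₀
  have hm₀1 : 1 ≤ m₀ := by rw [hm₀]; exact_mod_cast one_le_order hρ₀
  have hm₀0 : 0 < m₀ := by linarith
  have hm₀C : ((riemannZetaZeroOrder ρ₀ : ℤ) : ℂ) = (m₀ : ℂ) := by rw [hm₀]; norm_cast
  -- `|β − β₀| ≤ 1` on `S`
  have hS1 : ∀ ρ ∈ S, |ρ.re - ρ₀.re| ≤ 1 := fun ρ hρ ↦ by
    refine ((hS ρ hρ).2.2.1).trans ?_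
    rw [div_le_one (by positivity)]
    nlinarith [hA1, show (1 : ℝ) ≤ Real.log L ^ 3 from one_le_pow₀ (by linarith)]
  obtain ⟨hsumA, hsumB⟩ := sum_order_norm_W0_le hCb hC₁ hT4 hγ1 hγ2
    (S := S) (fun ρ hρ ↦ ⟨(hS ρ hρ).1, hS1 ρ hρ, (hS ρ hρ).2.2.2⟩)
  rw [← hL_def] at hsumA hsumB
  -- the data of Lemma 11
  set z : ℂ → ℂ := fun ρ ↦ ρ - ρ₀ with hz
  set c : ℂ → ℂ := fun ρ ↦ (riemannZetaZeroOrder ρ : ℂ) *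
    mellin (fun x : ℝ ↦ ((w0 x : ℝ) : ℂ)) (ρ - ρ₀) / ((m₀ : ℂ) * (Real.log 2 : ℂ)) with hc
  set B : ℝ := K₁ * L with hB
  have hBL : L ≤ B := by rw [hB]; nlinarith
  have hB1 : 1 ≤ B := hL1.trans hBL
  have hB0 : 0 < B := by linarith
  have hBB₀ : B₀ ≤ B := by linarith
  have hlogB : Real.log B ≤ 2 * Real.log L := by
    rw [hB, Real.log_mul (by linarith) hL0.ne', two_mul]
    gcongr
    linarith
  have hlogB0 : 0 ≤ Real.log B := Real.log_nonneg hB1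
  -- `c ρ = r • W₀(z ρ)` with `r = m(ρ)/(m₀ log 2) > 0`
  have hc_eq : ∀ ρ : ℂ, c ρ = (((riemannZetaZeroOrder ρ : ℝ) / (m₀ * Real.log 2) : ℝ) : ℂ) *
      mellin (fun x : ℝ ↦ ((w0 x : ℝ) : ℂ)) (ρ - ρ₀) := by
    intro ρ
    rw [hc]
    have h2 : (Real.log 2 : ℂ) ≠ 0 := by exact_mod_cast (by linarith : Real.log 2 ≠ 0)
    have hm : (m₀ : ℂ) ≠ 0 := by exact_mod_cast hm₀0.ne'
    push_cast
    field_simp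
  have hnorm_c : ∀ ρ ∈ S, ‖c ρ‖ ≤ (riemannZetaZeroOrder ρ : ℝ) *
      ‖mellin (fun x : ℝ ↦ ((w0 x : ℝ) : ℂ)) (ρ - ρ₀)‖ / Real.log 2 := by
    intro ρ hρ
    have hm := hmS ρ hρ
    rw [hc_eq ρ, norm_mul, Complex.norm_real, Real.norm_of_nonneg (by positivity)]
    have h1 : (riemannZetaZeroOrder ρ : ℝ) / (m₀ * Real.log 2) ≤ (riemannZetaZeroOrder ρ : ℝ) / Real.log 2 :=
      div_le_div_of_nonneg_left (by linarith) (by linarith) (by nlinarith)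
    calc (riemannZetaZeroOrder ρ : ℝ) / (m₀ * Real.log 2) * ‖mellin (fun x : ℝ ↦ ((w0 x : ℝ) : ℂ)) (ρ - ρ₀)‖
        ≤ (riemannZetaZeroOrder ρ : ℝ) / Real.log 2 * ‖mellin (fun x : ℝ ↦ ((w0 x : ℝ) : ℂ)) (ρ - ρ₀)‖ := by
          gcongr
      _ = _ := by ring
  -- (H5) `Σ |c ρ| ≤ B`
  have hH5 : ∑ ρ ∈ S, ‖c ρ‖ ≤ B := by
    calc ∑ ρ ∈ S, ‖c ρ‖ ≤ ∑ ρ ∈ S, (riemannZetaZeroOrder ρ : ℝ) *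
          ‖mellin (fun x : ℝ ↦ ((w0 x : ℝ) : ℂ)) (ρ - ρ₀)‖ / Real.log 2 :=
          Finset.sum_le_sum hnorm_c
      _ = (∑ ρ ∈ S, (riemannZetaZeroOrder ρ : ℝ) *
          ‖mellin (fun x : ℝ ↦ ((w0 x : ℝ) : ℂ)) (ρ - ρ₀)‖) / Real.log 2 := by
          rw [Finset.sum_div]
      _ ≤ (4 * Cb * C₁ * L) / Real.log 2 := by gcongr
      _ ≤ B := by
          rw [hB, hK₁]
          have : 4 * Cb * C₁ * L / Real.log 2 = (4 * Cb * C₁ / Real.log 2) * L := by ring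
          rw [this]
          nlinarith
  -- (H4) near-positivity of the coefficients with small `|Im z|`
  have hH4 : ∀ ρ ∈ S, |(z ρ).im| ≤ Real.log B ^ 2 / A → |(c ρ).arg| ≤ 1 / 10 := by
    intro ρ hρ hIm
    have hm := hmS ρ hρ
    have hre : |(z ρ).re| ≤ 1 / (10 * A) := by
      rw [hz]; simp only [sub_re]; exact (hS ρ hρ).2.2.1
    have hzn : ‖z ρ‖ ≤ (1 + Real.log B ^ 2) / A := by
      calc ‖z ρ‖ ≤ |(z ρ).re| + |(z ρ).im| := Complex.norm_le_abs_re_add_abs_im _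
        _ ≤ 1 / (10 * A) + Real.log B ^ 2 / A := add_le_add hre hIm
        _ ≤ (1 + Real.log B ^ 2) / A := by
            rw [div_add_div _ _ (by positivity) (by positivity), div_le_div_iff₀ (by positivity) hA0]
            nlinarith [sq_nonneg (Real.log B)]
    have hδ : (1 + Real.log B ^ 2) / A ≤ 1 / 100 := window_le hA1 hlogL hlogB hlogB0
    have hz1 : ‖z ρ‖ ≤ 1 := hzn.trans (hδ.trans (by norm_num))
    have hw := norm_W0_sub_log_two_le hz1
    set w : ℂ := mellin (fun x : ℝ ↦ ((w0 x : ℝ) : ℂ)) (z ρ) - Real.log 2 with hw_def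
    have hw' : ‖w‖ ≤ 1 / 20 := by
      calc ‖w‖ ≤ 5 * ‖z ρ‖ := hw
        _ ≤ 5 * (1 / 100) := by gcongr; exact hzn.trans hδ
        _ = 1 / 20 := by norm_num
    have hWeq : mellin (fun x : ℝ ↦ ((w0 x : ℝ) : ℂ)) (ρ - ρ₀) = (Real.log 2 : ℂ) + w := by
      rw [hw_def, hz]; ring
    have hr : 0 < (riemannZetaZeroOrder ρ : ℝ) / (m₀ * Real.log 2) := by positivity
    rw [hc_eq ρ, hWeq, Complex.arg_real_mul _ hr]
    exact abs_arg_log_two_add_le hw'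
  -- (H1)–(H3)
  have hH1 : ∃ i ∈ S, z i = 0 ∧ c i = 1 := by
    refine ⟨ρ₀, hρ₀S, by simp [hz], ?_⟩
    rw [hc]
    simp only [sub_self, W0_zero, hm₀C]
    have h2 : (Real.log 2 : ℂ) ≠ 0 := by exact_mod_cast (by linarith : Real.log 2 ≠ 0)
    have hm : (m₀ : ℂ) ≠ 0 := by exact_mod_cast hm₀0.ne'
    field_simp
  have hH2 : ∀ ρ ∈ S, 0 ≤ (z ρ).im := fun ρ hρ ↦ by
    rw [hz]; simp only [sub_im]; linarith [(hS ρ hρ).2.1]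
  have hH3 : ∀ ρ ∈ S, |(z ρ).re| ≤ 1 / (10 * A) := fun ρ hρ ↦ by
    rw [hz]; simp only [sub_re]; exact (hS ρ hρ).2.2.1
  -- apply Lemma 11
  obtain ⟨t₀, ⟨ht₀1, ht₀2⟩, hlow⟩ := h11 ℂ S z c A B hA0 hBB₀ hH1 hH2 hH3 hH4 hH5
  have hBpow : B ^ (-(99 : ℝ)) = (B ^ 99)⁻¹ := by
    rw [Real.rpow_neg hB0.le, show (99 : ℝ) = ((99 : ℕ) : ℝ) by norm_num, Real.rpow_natCast]
  rw [hBpow] at hlow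
  -- derivative input `Σ |c ρ| |z ρ| ≤ K₃ L³`
  have hD : ∑ ρ ∈ S, ‖c ρ‖ * ‖z ρ‖ ≤ K₃ * L ^ 3 := by
    calc ∑ ρ ∈ S, ‖c ρ‖ * ‖z ρ‖ ≤ ∑ ρ ∈ S, (riemannZetaZeroOrder ρ : ℝ) *
          ‖mellin (fun x : ℝ ↦ ((w0 x : ℝ) : ℂ)) (ρ - ρ₀)‖ / Real.log 2 * ‖ρ - ρ₀‖ :=
          Finset.sum_le_sum fun ρ hρ ↦ mul_le_mul_of_nonneg_right (hnorm_c ρ hρ) (norm_nonneg _)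
      _ = (∑ ρ ∈ S, (riemannZetaZeroOrder ρ : ℝ) *
          ‖mellin (fun x : ℝ ↦ ((w0 x : ℝ) : ℂ)) (ρ - ρ₀)‖ * ‖ρ - ρ₀‖) / Real.log 2 := by
          rw [Finset.sum_div]
          refine Finset.sum_congr rfl fun ρ _ ↦ by ring
      _ ≤ (4 * Cb * C₁ * L ^ 3) / Real.log 2 := by gcongr
      _ = K₃ * L ^ 3 := by rw [hK₃]; ring
  -- the grid
  set ℓ : ℝ := Real.log (1 + (L ^ 150)⁻¹) with hℓ_def
  have hL150 : (1 : ℝ) ≤ L ^ 150 := one_le_pow₀ hL1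
  have hinv0 : (0 : ℝ) < (L ^ 150)⁻¹ := by positivity
  have hinv1 : (L ^ 150)⁻¹ ≤ (1 : ℝ) := inv_le_one_of_one_le₀ hL150
  have hℓ0 : 0 < ℓ := Real.log_pos (by linarith)
  have hℓle : ℓ ≤ (L ^ 150)⁻¹ := by
    rw [hℓ_def]
    have := Real.log_le_sub_one_of_pos (by linarith : (0 : ℝ) < 1 + (L ^ 150)⁻¹)
    linarith
  have hℓ1 : ℓ ≤ 1 := hℓle.trans hinv1
  have hℓA : ℓ ≤ A := hℓ1.trans (le_trans (by norm_num) (le_trans (one_le_pow₀ (by linarith)) hA1))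
  obtain ⟨j, hj1, hj2, hj3⟩ := exists_nat_mul_mem_Icc hℓ0 hℓA ht₀1 ht₀2
  set u : ℝ := j * ℓ with hu_def
  -- `|g u| ≥ B^{-99}/2`
  have hmem : ∀ t : ℝ, |t - t₀| ≤ ℓ → t ∈ Icc (0 : ℝ) (3 * A) := by
    intro t ht
    rw [abs_le] at ht
    constructor <;> linarith
  set gu : ℂ := ∑ ρ ∈ S, c ρ * cexp ((u : ℂ) * z ρ) with hgu_def
  set g0 : ℂ := ∑ ρ ∈ S, c ρ * cexp ((t₀ : ℂ) * z ρ) with hg0_def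
  have hmv : ‖gu - g0‖ ≤ 2 * (K₃ * L ^ 3) * |u - t₀| :=
    norm_powerSum_sub_le (c := c) hA0 (fun ρ hρ ↦ (le_abs_self _).trans (hH3 ρ hρ)) hD
      (hmem u hj3) (hmem t₀ (by simp [hℓ0.le]))
  have hstep : 2 * (K₃ * L ^ 3) * |u - t₀| ≤ (B ^ 99)⁻¹ / 2 := by
    have h1 := grid_step_le (K₃ := K₃) hK₁1 hL1 (by linarith)
    have h2 : |u - t₀| ≤ (L ^ 150)⁻¹ := hj3.trans hℓle
    calc 2 * (K₃ * L ^ 3) * |u - t₀| ≤ 2 * (K₃ * L ^ 3) * (L ^ 150)⁻¹ := by gcongr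
      _ = 2 * (K₃ * L ^ 3 * (L ^ 150)⁻¹) := by ring
      _ ≤ 2 * (((K₁ * L) ^ 99)⁻¹ / 4) := by gcongr
      _ = (B ^ 99)⁻¹ / 2 := by rw [hB]; ring
  have hlow' : (B ^ 99)⁻¹ ≤ ‖g0‖ := hlow
  have hgu : (B ^ 99)⁻¹ / 2 ≤ ‖gu‖ := by
    have htri : ‖g0‖ - ‖gu‖ ≤ ‖gu - g0‖ := by
      rw [norm_sub_rev]; exact norm_sub_norm_le g0 gu
    linarith only [htri, hmv, hstep, hlow']
  -- the main sum is `m₀ log 2 · g(u)`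
  refine ⟨j, hj1, hj2, ?_⟩
  have hmain : ((m₀ : ℂ) * (Real.log 2 : ℂ)) * gu = ∑ ρ ∈ S, (riemannZetaZeroOrder ρ : ℂ) *
      (cexp ((u : ℂ) * (ρ - ρ₀)) * mellin (fun x : ℝ ↦ ((w0 x : ℝ) : ℂ)) (ρ - ρ₀)) :=
    mul_sum_coeff_eq S ρ₀ hm₀0.ne' u
  change 2 / L ^ 100 ≤ ‖∑ ρ ∈ S, (riemannZetaZeroOrder ρ : ℂ) *
    (cexp ((u : ℂ) * (ρ - ρ₀)) * mellin (fun x : ℝ ↦ ((w0 x : ℝ) : ℂ)) (ρ - ρ₀))‖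
  rw [← hmain, norm_mul, norm_mul, Complex.norm_real, Complex.norm_real,
    Real.norm_of_nonneg hm₀0.le, Real.norm_of_nonneg (by linarith : (0 : ℝ) ≤ Real.log 2)]
  have hfin := final_step_le hK₁1 hL1 (by linarith)
  rw [← hB] at hfin
  calc 2 / L ^ 100 ≤ Real.log 2 * ((B ^ 99)⁻¹ / 2) := hfin
    _ = 1 * Real.log 2 * ((B ^ 99)⁻¹ / 2) := by ring
    _ ≤ m₀ * Real.log 2 * ‖gu‖ := by gcongr

end MaynardPratt

end Literature.NumberTheory.LFunctions
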